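import Summits.NavierStokesRegularity.NavierStokesRegularity.Theorems.HodographBetchovSlowClassProductionDeepVorticity
import Literature.Analysis.FluidPDE.ConstantinDirectionDissipationProofs
import Literature.Analysis.FluidPDE.VorticityCalculus
import Literature.Analysis.FluidPDE.TaoEnstrophyLocalisationProofs
import Literature.Analysis.FluidPDE.TaoEnergyLocalisation
import Literature.Analysis.FluidPDE.SpaceTimeCalculusC1

/-!
# `SlowClassProduction` (stmt-NavierStokesRegularity-15831), line `birth` — stub 2 `stub_deepSlowProduction`

Route `HodographBetchov`, crux 2, registered skeleton `Cruxes/SlowClassProduction/Lines/birth.lean`.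
**Deep-slow production budget**: for a classical Navier–Stokes solution on `ℝ³ × [0,T)` that is
Leray–Hopf from a rapidly decaying datum, every level `l > 0`, delay `τ ∈ (0,T)` and radius `r` with
`0 < r ≤ ν/l`, `r² ≤ ν τ`, the enstrophy production `P = ⟪ω, ∇u ω⟫` is integrable on the DEEP piece
of the slow class — `0 < s < t`, `|u(s,x)| ≤ l`, `s ≥ τ`, `|u| ≤ l` on `[s − r²/ν, s] × B̄(x, r)` —
with `∫ |P| ≤ C` uniformly in `t < T`.

Proof (a priori, all inputs theorems of the tree).  By the Leray–Hopf energy inequality the total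
dissipation `D = ∫₀ᵀ∫ |∇u|²_F` is finite (`IsLerayHopfOn.lintegral_frobeniusNormSq_fderiv_of_classical`).
The helper `norm_curl_le_of_slow_cylinder` (`HodographBetchovSlowClassProductionDeepVorticity`:
viscosity rescaling + Serrin's quantitative spin bound up to the top) gives `‖ω‖ ≤ K` at every deep
point, whence `|P| ≤ ‖∇u‖ ‖ω‖² ≤ κ K |∇u|²_F` there (`κ = ‖curlCLM‖`), and the majorant
`κ K |∇u|²_F` is integrable on the whole slab `(0,T) × ℝ³` (Tonelli).  The deep piece is measurable:
inside the slab `τ ≤ s < t` it is cut out by the closed condition `|u(s − σ, x + η)| ≤ l` for all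
`(σ, η)` in the compact cylinder parameter set (continuity of `u` on `[0,T) × ℝ³`).  Domination on the
deep piece gives integrability and `∫ |P| ≤ κ K ∫∫_{(0,T)×ℝ³} |∇u|²_F`, uniformly in `t`.
-/

noncomputable section

-- the summit and its single problem share the name `NavierStokesRegularity` (D-0017 nested layout)
set_option linter.dupNamespace false

namespace Summit.NavierStokesRegularity.NavierStokesRegularity.Theorems.SlowClassProduction.Birth

open Set MeasureTheory Function Metric Filter Topology Literature.Analysis.FluidPDE
open scoped ENNReal NNReal ContDiff RealInnerProductSpace

/-- The deep piece of the slow class up to time `t`, rewritten: a point is deep-slow iff its time is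
below `t`, at least `τ`, and `|u| ≤ l` on the whole backward cylinder (which contains the point, so
the slowness of the point itself and `0 < s` are automatic for `τ > 0`, `r > 0`). [folklore] -/
theorem deepSlow_eq {u : ℝ → EuclideanSpace ℝ (Fin 3) → EuclideanSpace ℝ (Fin 3)} {ν l τ r t : ℝ}
    (hν : 0 < ν) (hτ : 0 < τ) (hr : 0 < r) :
    ({z : ℝ × EuclideanSpace ℝ (Fin 3) | z.1 ∈ Set.Ioo 0 t ∧ ‖u z.1 z.2‖ ≤ l} ∩
      {z : ℝ × EuclideanSpace ℝ (Fin 3) | τ ≤ z.1 ∧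
        ∀ s ∈ Set.Icc (z.1 - r ^ 2 / ν) z.1, ∀ y ∈ Metric.closedBall z.2 r, ‖u s y‖ ≤ l}) =
    {z : ℝ × EuclideanSpace ℝ (Fin 3) | z.1 ∈ Set.Ico τ t} ∩
      ⋂ σ ∈ Set.Icc (0 : ℝ) (r ^ 2 / ν), ⋂ η ∈ Metric.closedBall (0 : EuclideanSpace ℝ (Fin 3)) r,
        (fun z : ℝ × EuclideanSpace ℝ (Fin 3) => u (z.1 - σ) (z.2 + η)) ⁻¹'
          Metric.closedBall (0 : EuclideanSpace ℝ (Fin 3)) l := by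
  have hr2 : 0 ≤ r ^ 2 / ν := by positivity
  ext z
  simp only [mem_inter_iff, mem_setOf_eq, mem_iInter, mem_preimage, mem_closedBall, dist_zero_right,
    mem_Icc, mem_Ioo, mem_Ico]
  constructor
  · rintro ⟨⟨⟨-, hzt⟩, -⟩, hτz, hD⟩
    refine ⟨⟨hτz, hzt⟩, fun σ hσ η hη => ?_⟩
    refine hD (z.1 - σ) ⟨by linarith [hσ.2], by linarith [hσ.1]⟩ (z.2 + η) ?_
    simpa [dist_eq_norm] using hη
  · rintro ⟨⟨hτz, hzt⟩, hM⟩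
    have hD : ∀ s ∈ Set.Icc (z.1 - r ^ 2 / ν) z.1, ∀ y ∈ Metric.closedBall z.2 r, ‖u s y‖ ≤ l := by
      intro s hs y hy
      have hy' : ‖y - z.2‖ ≤ r := by rwa [mem_closedBall, dist_eq_norm] at hy
      have h := hM (z.1 - s) ⟨by linarith [hs.2], by linarith [hs.1]⟩ (y - z.2) hy'
      simpa [sub_sub_cancel, add_sub_cancel] using h
    refine ⟨⟨⟨hτ.trans_le hτz, hzt⟩, ?_⟩, hτz, hD⟩
    exact hD z.1 ⟨by linarith, le_rfl⟩ z.2 (mem_closedBall_self hr.le)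

/-- The deep piece of the slow class is measurable as soon as `u` is continuous on `[0,T) × ℝ³`,
`r² ≤ ν τ` and `t < T`: by `deepSlow_eq` it is a measurable time slab intersected with an
intersection of closed sublevel conditions of continuous maps (every shifted cylinder point of a
point of the closed slab `τ ≤ s ≤ t` stays in `[0,T) × ℝ³`). [folklore] -/
theorem measurableSet_deepSlow {u : ℝ → EuclideanSpace ℝ (Fin 3) → EuclideanSpace ℝ (Fin 3)}
    {ν l τ r t T : ℝ} (hν : 0 < ν) (hτ : 0 < τ) (hr : 0 < r) (hrτ : r ^ 2 ≤ ν * τ) (htT : t < T)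
    (hU : ContinuousOn (Function.uncurry u)
      (Set.Ico 0 T ×ˢ (Set.univ : Set (EuclideanSpace ℝ (Fin 3))))) :
    MeasurableSet ({z : ℝ × EuclideanSpace ℝ (Fin 3) | z.1 ∈ Set.Ioo 0 t ∧ ‖u z.1 z.2‖ ≤ l} ∩
      {z : ℝ × EuclideanSpace ℝ (Fin 3) | τ ≤ z.1 ∧
        ∀ s ∈ Set.Icc (z.1 - r ^ 2 / ν) z.1, ∀ y ∈ Metric.closedBall z.2 r, ‖u s y‖ ≤ l}) := by
  rw [deepSlow_eq hν hτ hr]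
  -- replace the half-open slab by the closed one inside the closed conditions
  have hστ : r ^ 2 / ν ≤ τ := by rw [div_le_iff₀ hν]; linarith
  have hclosed : ∀ σ ∈ Set.Icc (0 : ℝ) (r ^ 2 / ν), ∀ η : EuclideanSpace ℝ (Fin 3),
      IsClosed ({z : ℝ × EuclideanSpace ℝ (Fin 3) | z.1 ∈ Set.Icc τ t} ∩
        (fun z : ℝ × EuclideanSpace ℝ (Fin 3) => u (z.1 - σ) (z.2 + η)) ⁻¹'
          Metric.closedBall (0 : EuclideanSpace ℝ (Fin 3)) l) := by
    intro σ hσ η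
    refine ContinuousOn.preimage_isClosed_of_isClosed ?_ (isClosed_Icc.preimage continuous_fst)
      Metric.isClosed_closedBall
    have hg : Continuous fun z : ℝ × EuclideanSpace ℝ (Fin 3) =>
        ((z.1 - σ, z.2 + η) : ℝ × EuclideanSpace ℝ (Fin 3)) :=
      (continuous_fst.sub continuous_const).prodMk (continuous_snd.add continuous_const)
    have hmaps : Set.MapsTo (fun z : ℝ × EuclideanSpace ℝ (Fin 3) =>
        ((z.1 - σ, z.2 + η) : ℝ × EuclideanSpace ℝ (Fin 3)))
        {z : ℝ × EuclideanSpace ℝ (Fin 3) | z.1 ∈ Set.Icc τ t}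
        (Set.Ico 0 T ×ˢ (Set.univ : Set (EuclideanSpace ℝ (Fin 3)))) := by
      intro z hz
      refine Set.mk_mem_prod ⟨?_, ?_⟩ (Set.mem_univ _)
      · have h1 := hσ.2
        have h2 := hz.1
        change 0 ≤ z.1 - σ
        linarith
      · have h1 := hσ.1
        have h2 := hz.2
        change z.1 - σ < T
        linarith
    exact hU.comp hg.continuousOn hmaps
  -- the set equals the half-open slab intersected with the closed version
  have heq : ({z : ℝ × EuclideanSpace ℝ (Fin 3) | z.1 ∈ Set.Ico τ t} ∩
      ⋂ σ ∈ Set.Icc (0 : ℝ) (r ^ 2 / ν), ⋂ η ∈ Metric.closedBall (0 : EuclideanSpace ℝ (Fin 3)) r,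
        (fun z : ℝ × EuclideanSpace ℝ (Fin 3) => u (z.1 - σ) (z.2 + η)) ⁻¹'
          Metric.closedBall (0 : EuclideanSpace ℝ (Fin 3)) l) =
      {z : ℝ × EuclideanSpace ℝ (Fin 3) | z.1 ∈ Set.Ico τ t} ∩
      ⋂ σ ∈ Set.Icc (0 : ℝ) (r ^ 2 / ν), ⋂ η ∈ Metric.closedBall (0 : EuclideanSpace ℝ (Fin 3)) r,
        ({z : ℝ × EuclideanSpace ℝ (Fin 3) | z.1 ∈ Set.Icc τ t} ∩
          (fun z : ℝ × EuclideanSpace ℝ (Fin 3) => u (z.1 - σ) (z.2 + η)) ⁻¹'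
            Metric.closedBall (0 : EuclideanSpace ℝ (Fin 3)) l) := by
    ext z
    simp only [mem_inter_iff, mem_setOf_eq, mem_iInter, mem_Ico, mem_Icc]
    constructor
    · rintro ⟨hz, hM⟩
      exact ⟨hz, fun σ hσ η hη => ⟨⟨hz.1, hz.2.le⟩, hM σ hσ η hη⟩⟩
    · rintro ⟨hz, hM⟩
      exact ⟨hz, fun σ hσ η hη => (hM σ hσ η hη).2⟩
  rw [heq]
  refine (measurableSet_Ico.preimage measurable_fst).inter (IsClosed.measurableSet ?_)
  exact isClosed_biInter fun σ hσ => isClosed_biInter fun η _ => hclosed σ hσ η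

/-- **Stub `stub_deepSlowProduction` of line `birth` for the crux `SlowClassProduction`
(stmt-NavierStokesRegularity-15831): the deep-slow production budget.**  For `ν, T > 0`, a
classical solution `(u, p)` of the unforced Navier–Stokes system on `ℝ³ × [0,T)` which is
Leray–Hopf on `[0,T)` from its rapidly decaying datum, a level `l > 0`, a delay `τ ∈ (0,T)` and a
radius `r` with `0 < r ≤ ν/l`, `r² ≤ ν τ`, there is `C` such that for all `t < T` the enstrophy
production `⟪curl u, ∇u (curl u)⟫` is integrable on the deep piece of the slow class up to time `t`
(points `(s, x)` with `0 < s < t`, `|u(s,x)| ≤ l`, `s ≥ τ` and `|u| ≤ l` on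
`[s − r²/ν, s] × B̄(x, r)`) with `∫ |P| ≤ C`.  Proof: finite total dissipation
`D = ∫₀ᵀ∫ |∇u|²_F` (Leray–Hopf energy inequality, classical gradient = weak gradient), the a-priori
vorticity bound `‖ω‖ ≤ K` at deep points (`norm_curl_le_of_slow_cylinder`: Serrin's interior theory
at cylinder Reynolds number `l r/ν ≤ 1` after viscosity rescaling), the pointwise domination
`|P| ≤ ‖∇u‖ ‖ω‖² ≤ ‖curlCLM‖ K |∇u|²_F` on the (measurable) deep piece, and Tonelli for the
majorant on the slab `(0,T) × ℝ³`; `C = ‖curlCLM‖ K D`.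
[cite: RobinsonRodrigoSadowskiCUP2016, Thm. 13.7, proof §13.3.2 Steps 1–2] [cite: Leray1934, (5.2)] -/
theorem stub_deepSlowProduction :
    ∀ (ν T : ℝ), 0 < ν → 0 < T →
      ∀ (u : ℝ → EuclideanSpace ℝ (Fin 3) → EuclideanSpace ℝ (Fin 3))
        (p : ℝ → EuclideanSpace ℝ (Fin 3) → ℝ),
        Literature.Analysis.FluidPDE.IsClassicalNSSolutionOn (Set.Ico 0 T) ν 0 u p →
        Literature.Analysis.FluidPDE.IsLerayHopfOn T ν 0 (u 0) u →
        Literature.Analysis.FluidPDE.HasRapidSpatialDecay (u 0) →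
        ∀ l : ℝ, 0 < l → ∀ τ : ℝ, 0 < τ → τ < T → ∀ r : ℝ, 0 < r → r ≤ ν / l → r ^ 2 ≤ ν * τ →
          ∃ C : ℝ, ∀ t ∈ Set.Ico 0 T,
            MeasureTheory.IntegrableOn
              (fun z : ℝ × EuclideanSpace ℝ (Fin 3) =>
                inner ℝ (Literature.Analysis.FluidPDE.curl (u z.1) z.2)
                  (fderiv ℝ (u z.1) z.2 (Literature.Analysis.FluidPDE.curl (u z.1) z.2)))
              ({z : ℝ × EuclideanSpace ℝ (Fin 3) | z.1 ∈ Set.Ioo 0 t ∧ ‖u z.1 z.2‖ ≤ l} ∩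
                {z : ℝ × EuclideanSpace ℝ (Fin 3) | τ ≤ z.1 ∧
                  ∀ s ∈ Set.Icc (z.1 - r ^ 2 / ν) z.1, ∀ y ∈ Metric.closedBall z.2 r,
                    ‖u s y‖ ≤ l}) ∧
            ∫ z in ({z : ℝ × EuclideanSpace ℝ (Fin 3) | z.1 ∈ Set.Ioo 0 t ∧ ‖u z.1 z.2‖ ≤ l} ∩
                {z : ℝ × EuclideanSpace ℝ (Fin 3) | τ ≤ z.1 ∧
                  ∀ s ∈ Set.Icc (z.1 - r ^ 2 / ν) z.1, ∀ y ∈ Metric.closedBall z.2 r,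
                    ‖u s y‖ ≤ l}),
              |inner ℝ (Literature.Analysis.FluidPDE.curl (u z.1) z.2)
                (fderiv ℝ (u z.1) z.2 (Literature.Analysis.FluidPDE.curl (u z.1) z.2))| ≤ C := by
  intro ν T hν hT u p hcl hLH _hdec l _hl τ hτ _hτT r hr _hrl hrτ
  -- ### total dissipation and the deep vorticity bound
  set D : ℝ≥0∞ := ∫⁻ s in Ioo 0 T, ∫⁻ x, ENNReal.ofReal (frobeniusNormSq (fderiv ℝ (u s) x))
    with hD_def
  have hDfin : D ≠ ⊤ := (IsLerayHopfOn.lintegral_frobeniusNormSq_fderiv_of_classical hcl hLH hT).1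
  obtain ⟨K, hK⟩ := norm_curl_le_of_slow_cylinder ν T hν u p hcl hDfin l r hr
  set K' : ℝ := max K 0 with hK'_def
  have hK'0 : 0 ≤ K' := le_max_right _ _
  set κ : ℝ := ‖curlCLM‖ with hκ_def
  have hκ0 : 0 ≤ κ := by rw [hκ_def]; exact norm_nonneg curlCLM
  -- ### notation
  set Df : ℝ × EuclideanSpace ℝ (Fin 3) → EuclideanSpace ℝ (Fin 3) →L[ℝ] EuclideanSpace ℝ (Fin 3) :=
    fun z => fderiv ℝ (u z.1) z.2 with hDf_def
  set P : ℝ × EuclideanSpace ℝ (Fin 3) → ℝ :=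
    fun z => inner ℝ (curl (u z.1) z.2) (fderiv ℝ (u z.1) z.2 (curl (u z.1) z.2)) with hP_def
  set g : ℝ × EuclideanSpace ℝ (Fin 3) → ℝ := fun z => κ * K' * frobeniusNormSq (Df z) with hg_def
  have hg0 : ∀ z, 0 ≤ g z := fun z => by
    rw [hg_def]
    exact mul_nonneg (mul_nonneg hκ0 hK'0) (frobeniusNormSq_nonneg _)
  -- ### pointwise domination at points with bounded vorticity
  have hP_le : ∀ z : ℝ × EuclideanSpace ℝ (Fin 3), ‖curl (u z.1) z.2‖ ≤ K' → ‖P z‖ ≤ g z := by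
    intro z hω
    have hω0 : 0 ≤ ‖curl (u z.1) z.2‖ := norm_nonneg _
    have hωκ : ‖curl (u z.1) z.2‖ ≤ κ * ‖Df z‖ := norm_curl_le _ _
    calc ‖P z‖ ≤ ‖curl (u z.1) z.2‖ * ‖Df z (curl (u z.1) z.2)‖ := norm_inner_le_norm _ _
      _ ≤ ‖curl (u z.1) z.2‖ * (‖Df z‖ * ‖curl (u z.1) z.2‖) := by
          gcongr
          exact (Df z).le_opNorm _
      _ = ‖curl (u z.1) z.2‖ * ‖curl (u z.1) z.2‖ * ‖Df z‖ := by ring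
      _ ≤ K' * (κ * ‖Df z‖) * ‖Df z‖ := by gcongr
      _ = κ * K' * ‖Df z‖ ^ 2 := by ring
      _ ≤ κ * K' * frobeniusNormSq (Df z) := by
          gcongr
          exact sq_opNorm_le_frobeniusNormSq _
      _ = g z := by rw [hg_def]
  -- ### continuity on the open slab `(0,T) × ℝ³`
  have hclo : IsClassicalNSSolutionOn (Ioo 0 T) ν 0 u p :=
    hcl.mono Ioo_subset_Ico_self isOpen_Ioo.uniqueDiffOn
  have hDcont : ContinuousOn Df (Ioo 0 T ×ˢ univ) :=
    continuousOn_fderiv_slice_of_contDiffOn (hclo.smooth_velocity.of_le (by norm_cast))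
      isOpen_Ioo.uniqueDiffOn
  have hωcont : ContinuousOn (fun z : ℝ × EuclideanSpace ℝ (Fin 3) => curl (u z.1) z.2)
      (Ioo 0 T ×ˢ univ) :=
    curlCLM.continuous.comp_continuousOn hDcont
  have hPcont : ContinuousOn P (Ioo 0 T ×ˢ univ) := hωcont.inner (hDcont.clm_apply hωcont)
  have hgcont : ContinuousOn g (Ioo 0 T ×ˢ univ) :=
    continuousOn_const.mul (continuous_frobeniusNormSq_clm.comp_continuousOn hDcont)
  have hmeasS : MeasurableSet (Ioo (0 : ℝ) T ×ˢ (univ : Set (EuclideanSpace ℝ (Fin 3)))) :=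
    measurableSet_Ioo.prod MeasurableSet.univ
  -- ### the majorant is integrable on the slab (Tonelli)
  have hg_int : IntegrableOn g (Ioo (0 : ℝ) T ×ˢ (univ : Set (EuclideanSpace ℝ (Fin 3)))) := by
    refine ⟨hgcont.aestronglyMeasurable hmeasS, ?_⟩
    have hμ : (volume.restrict (Ioo (0 : ℝ) T ×ˢ (univ : Set (EuclideanSpace ℝ (Fin 3)))) :
        Measure (ℝ × EuclideanSpace ℝ (Fin 3))) =
        (volume.restrict (Ioo (0 : ℝ) T)).prod
          ((volume : Measure (EuclideanSpace ℝ (Fin 3))).restrict univ) := by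
      rw [Measure.prod_restrict, ← Measure.volume_eq_prod]
    change ∫⁻ z, ‖g z‖ₑ ∂(volume.restrict (Ioo (0 : ℝ) T ×ˢ (univ : Set (EuclideanSpace ℝ (Fin 3))))) < ⊤
    rw [hμ]
    calc ∫⁻ z, ‖g z‖ₑ ∂(volume.restrict (Ioo (0 : ℝ) T)).prod
            ((volume : Measure (EuclideanSpace ℝ (Fin 3))).restrict univ)
        ≤ ∫⁻ s in Ioo (0 : ℝ) T, ∫⁻ x in univ, ‖g (s, x)‖ₑ := lintegral_prod_le _
      _ = ∫⁻ s in Ioo (0 : ℝ) T, ∫⁻ x, ENNReal.ofReal (κ * K') *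
            ENNReal.ofReal (frobeniusNormSq (fderiv ℝ (u s) x)) := by
          simp only [Measure.restrict_univ]
          refine lintegral_congr fun s => lintegral_congr fun x => ?_
          rw [Real.enorm_eq_ofReal (hg0 (s, x)), hg_def]
          exact ENNReal.ofReal_mul (mul_nonneg hκ0 hK'0)
      _ = ENNReal.ofReal (κ * K') * D := by
          rw [hD_def, ← lintegral_const_mul' _ _ ENNReal.ofReal_ne_top]
          refine lintegral_congr fun s => ?_
          rw [lintegral_const_mul' _ _ ENNReal.ofReal_ne_top]
      _ < ⊤ := ENNReal.mul_lt_top ENNReal.ofReal_lt_top hDfin.lt_top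
  -- ### the budget, uniform in `t`
  refine ⟨∫ z in Ioo (0 : ℝ) T ×ˢ (univ : Set (EuclideanSpace ℝ (Fin 3))), g z, fun t ht => ?_⟩
  set A : Set (ℝ × EuclideanSpace ℝ (Fin 3)) :=
    ({z : ℝ × EuclideanSpace ℝ (Fin 3) | z.1 ∈ Set.Ioo 0 t ∧ ‖u z.1 z.2‖ ≤ l} ∩
      {z : ℝ × EuclideanSpace ℝ (Fin 3) | τ ≤ z.1 ∧
        ∀ s ∈ Set.Icc (z.1 - r ^ 2 / ν) z.1, ∀ y ∈ Metric.closedBall z.2 r, ‖u s y‖ ≤ l})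
    with hA_def
  change IntegrableOn P A ∧ ∫ z in A, |P z| ≤ _
  have hU : ContinuousOn (Function.uncurry u)
      (Set.Ico 0 T ×ˢ (Set.univ : Set (EuclideanSpace ℝ (Fin 3)))) :=
    hcl.smooth_velocity.continuousOn
  have hA : MeasurableSet A := measurableSet_deepSlow hν hτ hr hrτ ht.2 hU
  have hAsub : A ⊆ Ioo (0 : ℝ) T ×ˢ (univ : Set (EuclideanSpace ℝ (Fin 3))) := fun z hz =>
    mk_mem_prod ⟨hz.1.1.1, hz.1.1.2.trans ht.2⟩ (mem_univ _)
  -- deep points have a slow backward cylinder, hence bounded vorticity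
  have hστ : r ^ 2 / ν ≤ τ := by rw [div_le_iff₀ hν]; linarith
  have hωA : ∀ z ∈ A, ‖curl (u z.1) z.2‖ ≤ K' := by
    intro z hz
    obtain ⟨⟨hzt, -⟩, hτz, hDz⟩ := hz
    exact (hK z.1 (hστ.trans hτz) (hzt.2.trans ht.2) z.2 hDz).trans (le_max_left _ _)
  have hPA : IntegrableOn P A := by
    refine Integrable.mono' (hg_int.mono_set hAsub) ((hPcont.mono hAsub).aestronglyMeasurable hA) ?_
    exact (ae_restrict_iff' hA).2 (ae_of_all _ fun z hz => hP_le z (hωA z hz))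
  refine ⟨hPA, ?_⟩
  calc ∫ z in A, |P z| ≤ ∫ z in A, g z := by
        refine setIntegral_mono_on hPA.abs (hg_int.mono_set hAsub) hA fun z hz => ?_
        rw [← Real.norm_eq_abs]
        exact hP_le z (hωA z hz)
    _ ≤ ∫ z in Ioo (0 : ℝ) T ×ˢ (univ : Set (EuclideanSpace ℝ (Fin 3))), g z :=
        setIntegral_mono_set hg_int (ae_of_all _ hg0) hAsub.eventuallyLE

end Summit.NavierStokesRegularity.NavierStokesRegularity.Theorems.SlowClassProduction.Birth

end
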